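import Mathlib
import HarnessLib
import Summits.Ventures.LatticeQCDFlow.Scoring.IMHWeightBlindTauESS
import Summits.Ventures.LatticeQCDFlow.Scaling.AcceptanceEssNoCeiling

/-!
# LatticeQCDFlow / Scoring — the acceptance monitor does NOT control the weight-blind `τ_int`:
# for every `δ > 0` and `T` there is a flow with `ā > 1 − δ` and `τ_int(f) ≥ T`

HONEST FRAMING: exact (Metropolis-corrected) sampling algorithms for lattice gauge theory;
figures of merit are autocorrelation/cost numbers at stated couplings and volumes; no
continuum-physics claim.

Venture `LatticeQCDFlow` (cell pub-lqcd), sub-topic `Scoring`; FANOUT row 3 (`s0-u1-a`, S0-B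
implementation A, GEN-11).  NEW WORK of the cell (a witness), not a published result; NO definition
is introduced.  Row 3's `Scoring/IMHWeightBlindTauESS` (imported) pins the weight-blind integrated
autocorrelation time of the exact flow-MCMC chain by the ESS fraction,
`1/ESS − 1/2 ≤ τ_int(f) ≤ 2/ESS − 1/2`; row 8's floor `τ_int(f) ≥ 1/ā − 1/2` uses the acceptance.
Could the ACCEPTANCE also give a ceiling?  No: row 3's heavy-tail pairs
(`Scaling/AcceptanceEssNoCeiling`, imported: `essFrac = e` exactly with `acc > 1 − δ`) have
acceptance as close to `1` as desired with ESS as small as desired, and `τ_int ≥ 1/ESS − 1/2`.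

* `heavyTail_pos` — for `0 < s < 1` the heavy-tail target is POSITIVE (the imported witness allows
  `s = 1`, where one atom is empty);
* **`exists_accRate_gt_and_inv_essFrac_ge`** — for every `δ > 0` and every `T` a positive
  normalised pair on two points with `acc > 1 − δ` and `1/ESS ≥ T`;
* **`exists_accRate_gt_and_blind_tauInt_ge`** — THE WITNESS ON THE CHAIN: for every `δ > 0` and
  `T` a weight-blind product chain (levels `Fin 2`, labels `Fin 2` with the fair label law and the
  observable `g = (1, −1)`) whose stationary acceptance exceeds `1 − δ` while `τ_int(g) ≥ T`.

Reading (value-free): a near-perfect acceptance monitor is compatible with arbitrarily slow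
decorrelation of label-type (weight-blind) observables; the ESS monitor is the one that certifies
it (previous file).  NOT CLAIMED: anything about observables correlated with the weight; any number
of ours.
-/

namespace Summit.Ventures.LatticeQCDFlow.Scoring

open Finset Literature.Probability.MarkovChains Summit.Ventures.LatticeQCDFlow.Exactness
open Summit.Ventures.LatticeQCDFlow.Theory2

/-- For `0 < s < 1`, `V > 0` the heavy-tail target `(V(1 − s), s(s + V))/(V + s²)` is positive.
[ours] -/
theorem heavyTail_pos {V s : ℝ} (hV : 0 < V) (hs : 0 < s) (hs1 : s < 1) :
    ∀ x, 0 < ![V * (1 - s) / (V + s ^ 2), s * (s + V) / (V + s ^ 2)] x := by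
  have hD : 0 < V + s ^ 2 := by positivity
  intro x
  fin_cases x
  · exact div_pos (mul_pos hV (by linarith)) hD
  · exact div_pos (mul_pos hs (by linarith)) hD

/-- **Acceptance near `1`, ESS as small as desired**: for every `δ > 0` and `T` there is a positive
normalised pair on two points with `acc > 1 − δ` and `1/ESS ≥ T`. [ours] -/
theorem exists_accRate_gt_and_inv_essFrac_ge (δ T : ℝ) (hδ : 0 < δ) :
    ∃ p q : Fin 2 → ℝ, (∀ x, 0 < p x) ∧ (∀ x, 0 < q x) ∧ ∑ x, p x = 1 ∧ ∑ x, q x = 1 ∧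
      1 - δ < accRate p q ∧ T ≤ (essFrac p q)⁻¹ := by
  set T' : ℝ := max T 2 with hT'
  have hT'2 : 2 ≤ T' := le_max_right _ _
  have hT'pos : 0 < T' := by linarith
  set e : ℝ := 1 / T' with he
  have he0 : 0 < e := by positivity
  have he1 : e < 1 := by
    rw [he, div_lt_one hT'pos]; linarith
  set V : ℝ := 1 / e - 1 with hV
  have hVpos : 0 < V := by
    rw [hV, sub_pos, lt_div_iff₀ he0]; linarith
  set s : ℝ := min (1 / 2) (δ / 2) with hs
  have hs0 : 0 < s := lt_min (by norm_num) (by linarith)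
  have hs1 : s < 1 := lt_of_le_of_lt (min_le_left _ _) (by norm_num)
  have hsδ : s < δ := lt_of_le_of_lt (min_le_right _ _) (by linarith)
  obtain ⟨-, hq, hp1, hq1⟩ := heavyTail_sums hVpos hs0 hs1.le
  refine ⟨_, _, heavyTail_pos hVpos hs0 hs1, hq, hp1, hq1, ?_, ?_⟩
  · rw [heavyTail_accRate hVpos hs0]
    have hDpos : 0 < V + s ^ 2 := by positivity
    have h1 : V * s / (V + s ^ 2) ≤ s := by
      rw [div_le_iff₀ hDpos]
      nlinarith [pow_pos hs0 3]
    linarith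
  · rw [heavyTail_essFrac hVpos hs0 hs1.le, hV]
    have : (1 : ℝ) / (1 + (1 / e - 1)) = e := by
      rw [add_sub_cancel, one_div_one_div]
    rw [this, he, one_div, inv_inv]
    exact le_max_left _ _

/-- **THE WITNESS ON THE CHAIN.**  For every `δ > 0` and every `T` there are positive normalised
level laws `pL, qL` on `Fin 2` such that, with the fair label law `μ = (½, ½)` and the weight-blind
observable `g = (1, −1)`, the exact flow-MCMC chain for target `pL ⊗ μ` and model `qL ⊗ μ` has
stationary acceptance `accRate pL qL > 1 − δ` and `τ_int(g) ≥ T`. [ours] -/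
theorem exists_accRate_gt_and_blind_tauInt_ge (δ T : ℝ) (hδ : 0 < δ) :
    ∃ pL qL : Fin 2 → ℝ, (∀ l, 0 < pL l) ∧ (∀ l, 0 < qL l) ∧ ∑ l, pL l = 1 ∧ ∑ l, qL l = 1 ∧
      1 - δ < accRate pL qL ∧
      T ≤ tauInt (fun t => twoTime (fun z : Fin 2 × Fin 2 => pL z.1 * ![(1/2 : ℝ), 1/2] z.2)
        (imhMatrix (fun z : Fin 2 × Fin 2 => pL z.1 * ![(1/2 : ℝ), 1/2] z.2)
          (fun z => qL z.1 * ![(1/2 : ℝ), 1/2] z.2)) t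
        (fun z => ![(1 : ℝ), -1] z.2) (fun z => ![(1 : ℝ), -1] z.2) /
      twoTime (fun z : Fin 2 × Fin 2 => pL z.1 * ![(1/2 : ℝ), 1/2] z.2)
        (imhMatrix (fun z : Fin 2 × Fin 2 => pL z.1 * ![(1/2 : ℝ), 1/2] z.2)
          (fun z => qL z.1 * ![(1/2 : ℝ), 1/2] z.2)) 0
        (fun z => ![(1 : ℝ), -1] z.2) (fun z => ![(1 : ℝ), -1] z.2)) := by
  obtain ⟨pL, qL, hp, hq, hp1, hq1, hacc, hT⟩ :=
    exists_accRate_gt_and_inv_essFrac_ge δ (T + 1 / 2) hδ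
  have hμ : ∀ y, 0 < (![(1/2 : ℝ), 1/2] : Fin 2 → ℝ) y := by
    intro y; fin_cases y <;> norm_num
  have hμ1 : ∑ y, (![(1/2 : ℝ), 1/2] : Fin 2 → ℝ) y = 1 := by
    simp only [Fin.sum_univ_two, Matrix.cons_val_zero, Matrix.cons_val_one]
    norm_num
  have hg : ∑ y, (![(1/2 : ℝ), 1/2] : Fin 2 → ℝ) y * (![(1 : ℝ), -1] : Fin 2 → ℝ) y = 0 := by
    simp only [Fin.sum_univ_two, Matrix.cons_val_zero, Matrix.cons_val_one]
    norm_num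
  have hvar : ∑ y, (![(1/2 : ℝ), 1/2] : Fin 2 → ℝ) y * (![(1 : ℝ), -1] : Fin 2 → ℝ) y ^ 2 ≠ 0 := by
    simp only [Fin.sum_univ_two, Matrix.cons_val_zero, Matrix.cons_val_one]
    norm_num
  refine ⟨pL, qL, hp, hq, hp1, hq1, hacc, ?_⟩
  have h := blind_tauInt_ge_inv_essFrac hp hp1 hq hq1 hμ hμ1 hg hvar
  linarith

end Summit.Ventures.LatticeQCDFlow.Scoring
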